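import Mathlib
import HarnessLib
import Summits.Ventures.LatticeQCDFlow.Exactness.IMHDensityStartL2
import Summits.Ventures.LatticeQCDFlow.Scaling.AutoregressiveGaugeAllClosingColdExact

/-!
# LatticeQCDFlow / Scaling — the exact all-closing conditioner (`A = Z/∏_ℓ c_{#C_ℓ}`) started from a draw of its own proposal forgets in `L²`: `|E_q f(U_n) − π f| ≤ (1 − A)ⁿ·√(E_q[ρ] − 1)·√(Var_π f)`, `ρ = dq/dπ` the explicit proposal-to-target density, `E_q[ρ] − 1 = χ²(q‖π)`

HONEST FRAMING: exact (Metropolis-corrected) sampling algorithms for lattice gauge theory;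
figures of merit are autocorrelation/cost numbers at stated couplings and volumes; no
continuum-physics claim.

Venture `LatticeQCDFlow` (cell pub-lqcd), topic `Scaling`, FANOUT row 30 (lean-1, GEN-35) — OUR WORK, the gauge instance of this
generation's abstract `Exactness/IMHDensityStartL2`.  Setting as in GEN-28's `allClosing_cold_acceptMass_eq`: exact sampler `K = indepMH q w`, cold
configuration `U ≡ 1` = the mode of the importance weight, `A = Z/∏_ℓ c_{#C_ℓ}`; the proposal `q` has the explicit density `ρ(U)` (the quotient printed in
the statements) with respect to the target `π`, the kernel weight is `ρ⁻¹`, bounded below (`w ≥ m > 0` on the group) — so the hot start `U_0 ∼ q`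
is a start with the bounded density `ρ` and GEN-34/35's range laws are complemented by an `L²` law:

* **`allClosing_hotStart_bias_abs_le_chiSq`** — `|E_q f(U_n) − π f| ≤ (1 − A)ⁿ·√(E_q[ρ] − 1)·√(Var_π f)`: the proposal's
  χ²-divergence from the target (a proposal-side statistic) times the observable's standard deviation;
* **`allClosing_hotStart_windowAverage_bias_abs_le_chiSq`** — `|E_q[A_{N,b}] − π f| ≤ √(E_q[ρ] − 1)·√(Var_π f)·(1 − A)^b·S_N/N`.

NOT CLAIMED: any value of `E_q[ρ]` or `A`; statistics of the whole run beyond window averages; that the `L²` law beats the range law for a particular observable.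

The `Fact` instance is the measurability of the kernel weight (discharged by the measurability clause of GEN-28's
acceptance-mass theorem).  No `def`, no `sorry`, nothing cited as a fact beyond the tree.
-/

noncomputable section

namespace Summit.Ventures.LatticeQCDFlow.Theory2.Autoregressive

open MeasureTheory ProbabilityTheory Function Finset
open scoped ENNReal
open Literature.MathematicalPhysics.QuantumFieldTheory Literature.MathematicalPhysics.QuantumLattice
open Summit.Ventures.LatticeQCDFlow.Exactness Summit.Ventures.LatticeQCDFlow.Scoring

variable {d L : ℕ} [NeZero L] {G : Type*} [Group G] [TopologicalSpace G] [IsTopologicalGroup G]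
  [CompactSpace G] [SecondCountableTopology G] [MeasurableSpace G] [BorelSpace G]

/-- **THE HOT START IN `L²`** (the run started from a draw `U_0 ∼ q` of the autoregressive proposal): for bounded measurable `f` and every `n`, `|E_q f(U_n) − π f| ≤ (1 − A)ⁿ·√(E_q[ρ] − 1)·√(Var_π f)`, where `ρ = dq/dπ` is the explicit density of the proposal with respect to the target (printed below) and `E_q[ρ] − 1 = χ²(q‖π)` — the proposal's χ²-divergence from the target times the observable's standard deviation, at the exact rate; for an observable with small variance this beats the range law `(1 − A)^{n+1}·D` (exact all-closing conditioner, `A = Z/∏_ℓ c_{#C_ℓ}`). [ours] -/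
theorem allClosing_hotStart_bias_abs_le_chiSq [MeasurableSingletonClass G] (hL : 2 ≤ L) {w : G → ℝ} (hw : Continuous w) {m M : ℝ} (hm0 : 0 < m)
    (hm : ∀ g, m ≤ w g) (hM : ∀ g, w g ≤ M) (hwinv : ∀ g, w g⁻¹ = w g)
    (T : Finset (Edge d L)) (C : Edge d L → Finset (Plaquette d L))
    (hCne : ∀ ℓ ∈ T, (C ℓ).Nonempty)
    (hCe : ∀ ℓ ∈ T, ∀ p ∈ C ℓ, ℓ ∈ ({(p.1, p.2.1.1), (p.1.shift p.2.1.1, p.2.1.2),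
        (p.1.shift p.2.1.2, p.2.1.1), (p.1, p.2.1.2)} : Finset (Edge d L)))
    (hdisj : ∀ ℓ ∈ T, ∀ ℓ' ∈ T, ℓ ≠ ℓ' → Disjoint (C ℓ) (C ℓ'))
    (hcover : ∀ p : Plaquette d L, ∃ ℓ ∈ T, p ∈ C ℓ)
    (π q : Measure (GaugeConfig d L G)) [IsProbabilityMeasure π] [IsProbabilityMeasure q]
    (hπ : π = (Measure.pi fun _ : Edge d L => haarProbability G).withDensity fun U =>
      ENNReal.ofReal ((∏ p : Plaquette d L, w (plaquetteHolonomy U p.1 p.2.1.1 p.2.1.2)) /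
        ∫ V, ∏ p : Plaquette d L, w (plaquetteHolonomy V p.1 p.2.1.1 p.2.1.2) ∂(Measure.pi fun _ : Edge d L => haarProbability G)))
    (hq : q = (Measure.pi fun _ : Edge d L => haarProbability G).withDensity fun U =>
      ENNReal.ofReal (∏ ℓ ∈ T, (∏ p ∈ C ℓ, w (plaquetteHolonomy U p.1 p.2.1.1 p.2.1.2)) /
          (∫ v, ∏ p ∈ C ℓ, w (plaquetteHolonomy (update U ℓ v) p.1 p.2.1.1 p.2.1.2) ∂(haarProbability G))))
    [Fact (Measurable (fun U =>
        (((∫ V, ∏ p : Plaquette d L, w (plaquetteHolonomy V p.1 p.2.1.1 p.2.1.2) ∂(Measure.pi fun _ : Edge d L => haarProbability G)) /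
          ∏ ℓ ∈ T, (∫ v, ∏ p ∈ C ℓ, w (plaquetteHolonomy (update U ℓ v) p.1 p.2.1.1 p.2.1.2) ∂(haarProbability G))))⁻¹))]
    {f : GaugeConfig d L G → ℝ} (hf : Measurable f) {Cf : ℝ} (hCf : ∀ U, |f U| ≤ Cf) (n : ℕ) :
    |∫ U, f U ∂((fun μ : Measure (GaugeConfig d L G) => μ.bind (indepMH q (fun U =>
        (((∫ V, ∏ p : Plaquette d L, w (plaquetteHolonomy V p.1 p.2.1.1 p.2.1.2) ∂(Measure.pi fun _ : Edge d L => haarProbability G)) /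
          ∏ ℓ ∈ T, (∫ v, ∏ p ∈ C ℓ, w (plaquetteHolonomy (update U ℓ v) p.1 p.2.1.1 p.2.1.2) ∂(haarProbability G))))⁻¹)))^[n] q) - ∫ U, f U ∂π| ≤
      (1 - ((∫ V, ∏ p : Plaquette d L, w (plaquetteHolonomy V p.1 p.2.1.1 p.2.1.2) ∂(Measure.pi fun _ : Edge d L => haarProbability G)) /
        ∏ ℓ ∈ T, ∫ h, w h ^ (C ℓ).card ∂(haarProbability G))) ^ n *
        (Real.sqrt (∫ U, ((∫ V, ∏ p : Plaquette d L, w (plaquetteHolonomy V p.1 p.2.1.1 p.2.1.2) ∂(Measure.pi fun _ : Edge d L => haarProbability G)) /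
          ∏ ℓ ∈ T, (∫ v, ∏ p ∈ C ℓ, w (plaquetteHolonomy (update U ℓ v) p.1 p.2.1.1 p.2.1.2) ∂(haarProbability G))) ∂q - 1) *
          Real.sqrt (∫ U, (f U - ∫ V, f V ∂π) ^ 2 ∂π)) := by
  obtain ⟨hA, hρq, hmax, hρm, hρpos⟩ := allClosing_cold_acceptMass_eq hL hw hm0 hm hM hwinv T C hCne hCe hdisj hcover π q hπ hq
  set cold : GaugeConfig d L G := fun _ => (1 : G) with hcold
  set ρ : GaugeConfig d L G → ℝ := fun U =>
    ((∫ V, ∏ p : Plaquette d L, w (plaquetteHolonomy V p.1 p.2.1.1 p.2.1.2) ∂(Measure.pi fun _ : Edge d L => haarProbability G)) /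
      ∏ ℓ ∈ T, (∫ v, ∏ p ∈ C ℓ, w (plaquetteHolonomy (update U ℓ v) p.1 p.2.1.1 p.2.1.2) ∂(haarProbability G))) with hρ
  have hw0' : ∀ U, 0 < (ρ U)⁻¹ := fun U => inv_pos.2 (hρpos U)
  have hπ' : (q.withDensity fun U => ENNReal.ofReal (ρ U)⁻¹) = π := withDensity_inv_density hρm hρpos hρq
  haveI : IsProbabilityMeasure (q.withDensity fun U => ENNReal.ofReal (ρ U)⁻¹) := by rw [hπ']; infer_instance
  have hone : ∫⁻ y, ENNReal.ofReal (ρ y)⁻¹ ∂q = ENNReal.ofReal 1 := by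
    have h : π Set.univ = 1 := measure_univ
    rw [← hπ', withDensity_apply _ MeasurableSet.univ, Measure.restrict_univ] at h
    rw [h, ENNReal.ofReal_one]
  have hA' := imhAcceptMass_toReal_eq_of_forall_le (q := q) hw0' cold hmax zero_le_one hone
  have hrate : ((ρ cold)⁻¹)⁻¹ = ((∫ V, ∏ p : Plaquette d L, w (plaquetteHolonomy V p.1 p.2.1.1 p.2.1.2) ∂(Measure.pi fun _ : Edge d L => haarProbability G)) /
        ∏ ℓ ∈ T, ∫ h, w h ^ (C ℓ).card ∂(haarProbability G)) := by
    rw [← hA, hA', one_div]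
  have hw0g : ∀ g, 0 < w g := fun g => hm0.trans_le (hm g)
  have hcpos : 0 < ∫ g, w g ∂(haarProbability G) := haarProbability_integral_pos_of_continuous_pos hw hw0g
  have hNlo : ∀ ℓ ∈ T, ∀ U : GaugeConfig d L G, m ^ ((C ℓ).card - 1) * (∫ g, w g ∂(haarProbability G)) ≤
      (∫ v, ∏ p ∈ C ℓ, w (plaquetteHolonomy (update U ℓ v) p.1 p.2.1.1 p.2.1.2) ∂(haarProbability G)) := by
    intro ℓ hℓ U
    obtain ⟨p₀, hp₀⟩ := hCne ℓ hℓ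
    exact normaliser_ge hL hw hm0 hm (C ℓ) ℓ hp₀ (hCe ℓ hℓ p₀ hp₀) U
  have hlopos : ∀ ℓ ∈ T, 0 < m ^ ((C ℓ).card - 1) * (∫ g, w g ∂(haarProbability G)) :=
    fun ℓ _ => mul_pos (pow_pos hm0 _) hcpos
  have hNPge : ∀ U : GaugeConfig d L G, ∏ ℓ ∈ T, m ^ ((C ℓ).card - 1) * (∫ g, w g ∂(haarProbability G)) ≤
      ∏ ℓ ∈ T, (∫ v, ∏ p ∈ C ℓ, w (plaquetteHolonomy (update U ℓ v) p.1 p.2.1.1 p.2.1.2) ∂(haarProbability G)) :=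
    fun U => Finset.prod_le_prod (fun ℓ hℓ => (hlopos ℓ hℓ).le) fun ℓ hℓ => hNlo ℓ hℓ U
  have hLpos : 0 < ∏ ℓ ∈ T, m ^ ((C ℓ).card - 1) * (∫ g, w g ∂(haarProbability G)) :=
    Finset.prod_pos fun ℓ hℓ => hlopos ℓ hℓ
  have hne := div_ne_zero_iff.1 (hρpos cold).ne'
  have hZT : (∫ V, ∏ p : Plaquette d L, w (plaquetteHolonomy V p.1 p.2.1.1 p.2.1.2)
      ∂(Measure.pi fun _ : Edge d L => haarProbability G)) ≠ 0 := hne.1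
  have hZTpos : 0 < (∫ V, ∏ p : Plaquette d L, w (plaquetteHolonomy V p.1 p.2.1.1 p.2.1.2)
      ∂(Measure.pi fun _ : Edge d L => haarProbability G)) := by
    have h := hρpos cold
    exact (div_pos_iff.1 h).elim (fun h => h.1) fun h => absurd h.2 (not_lt.2 (le_of_lt
      (Finset.prod_pos fun ℓ hℓ => lt_of_lt_of_le (hlopos ℓ hℓ) (hNlo ℓ hℓ cold))))
  have hwmin : 0 < (∏ ℓ ∈ T, m ^ ((C ℓ).card - 1) * (∫ g, w g ∂(haarProbability G))) /
      (∫ V, ∏ p : Plaquette d L, w (plaquetteHolonomy V p.1 p.2.1.1 p.2.1.2)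
        ∂(Measure.pi fun _ : Edge d L => haarProbability G)) := div_pos hLpos hZTpos
  have hge : ∀ U, (∏ ℓ ∈ T, m ^ ((C ℓ).card - 1) * (∫ g, w g ∂(haarProbability G))) /
      (∫ V, ∏ p : Plaquette d L, w (plaquetteHolonomy V p.1 p.2.1.1 p.2.1.2)
        ∂(Measure.pi fun _ : Edge d L => haarProbability G)) ≤ (ρ U)⁻¹ := by
    intro U
    rw [hρ]
    dsimp only
    rw [inv_div]
    exact div_le_div_of_nonneg_right (hNPge U) hZTpos.le
  have h := integral_iterate_bind_hotStart_abs_le_chiSq (q := q) hw0' hmax hwmin hge hf hCf n (x₀ := cold)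
  rw [hπ', hrate] at h
  simp only [inv_inv] at h
  exact h

/-- **THE HOT WINDOW-AVERAGE BIAS IN `L²`**: `|E_q[(1/N)Σ_{i<N} f(U_{b+i})] − π f| ≤ √(E_q[ρ] − 1)·√(Var_π f)·(1 − A)^b·S_N/N`, `S_N = Σ_{t<N}(1 − A)^t ≤ min(N, 1/A)`, for bounded measurable `f`, every `b`, `N ≥ 1` (exact all-closing conditioner, `A = Z/∏_ℓ c_{#C_ℓ}`). [ours] -/
theorem allClosing_hotStart_windowAverage_bias_abs_le_chiSq [MeasurableSingletonClass G] (hL : 2 ≤ L) {w : G → ℝ} (hw : Continuous w) {m M : ℝ} (hm0 : 0 < m)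
    (hm : ∀ g, m ≤ w g) (hM : ∀ g, w g ≤ M) (hwinv : ∀ g, w g⁻¹ = w g)
    (T : Finset (Edge d L)) (C : Edge d L → Finset (Plaquette d L))
    (hCne : ∀ ℓ ∈ T, (C ℓ).Nonempty)
    (hCe : ∀ ℓ ∈ T, ∀ p ∈ C ℓ, ℓ ∈ ({(p.1, p.2.1.1), (p.1.shift p.2.1.1, p.2.1.2),
        (p.1.shift p.2.1.2, p.2.1.1), (p.1, p.2.1.2)} : Finset (Edge d L)))
    (hdisj : ∀ ℓ ∈ T, ∀ ℓ' ∈ T, ℓ ≠ ℓ' → Disjoint (C ℓ) (C ℓ'))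
    (hcover : ∀ p : Plaquette d L, ∃ ℓ ∈ T, p ∈ C ℓ)
    (π q : Measure (GaugeConfig d L G)) [IsProbabilityMeasure π] [IsProbabilityMeasure q]
    (hπ : π = (Measure.pi fun _ : Edge d L => haarProbability G).withDensity fun U =>
      ENNReal.ofReal ((∏ p : Plaquette d L, w (plaquetteHolonomy U p.1 p.2.1.1 p.2.1.2)) /
        ∫ V, ∏ p : Plaquette d L, w (plaquetteHolonomy V p.1 p.2.1.1 p.2.1.2) ∂(Measure.pi fun _ : Edge d L => haarProbability G)))
    (hq : q = (Measure.pi fun _ : Edge d L => haarProbability G).withDensity fun U =>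
      ENNReal.ofReal (∏ ℓ ∈ T, (∏ p ∈ C ℓ, w (plaquetteHolonomy U p.1 p.2.1.1 p.2.1.2)) /
          (∫ v, ∏ p ∈ C ℓ, w (plaquetteHolonomy (update U ℓ v) p.1 p.2.1.1 p.2.1.2) ∂(haarProbability G))))
    [Fact (Measurable (fun U =>
        (((∫ V, ∏ p : Plaquette d L, w (plaquetteHolonomy V p.1 p.2.1.1 p.2.1.2) ∂(Measure.pi fun _ : Edge d L => haarProbability G)) /
          ∏ ℓ ∈ T, (∫ v, ∏ p ∈ C ℓ, w (plaquetteHolonomy (update U ℓ v) p.1 p.2.1.1 p.2.1.2) ∂(haarProbability G))))⁻¹))]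
    {f : GaugeConfig d L G → ℝ} (hf : Measurable f) {Cf : ℝ} (hCf : ∀ U, |f U| ≤ Cf) (b : ℕ) {N : ℕ} (hN : N ≠ 0) :
    |∫ x, (∑ i ∈ range N, f (x (b + i))) / N ∂(Kernel.trajMeasure (X := fun _ : ℕ => GaugeConfig d L G) q
        (fun n : ℕ => (indepMH q (fun U =>
        (((∫ V, ∏ p : Plaquette d L, w (plaquetteHolonomy V p.1 p.2.1.1 p.2.1.2) ∂(Measure.pi fun _ : Edge d L => haarProbability G)) /
          ∏ ℓ ∈ T, (∫ v, ∏ p ∈ C ℓ, w (plaquetteHolonomy (update U ℓ v) p.1 p.2.1.1 p.2.1.2) ∂(haarProbability G))))⁻¹)).comap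
          (fun h : (i : ↥(Finset.Iic n)) → GaugeConfig d L G => h ⟨n, Finset.mem_Iic.2 le_rfl⟩)
          (measurable_pi_apply _))) - ∫ U, f U ∂π| ≤
      Real.sqrt (∫ U, ((∫ V, ∏ p : Plaquette d L, w (plaquetteHolonomy V p.1 p.2.1.1 p.2.1.2) ∂(Measure.pi fun _ : Edge d L => haarProbability G)) /
          ∏ ℓ ∈ T, (∫ v, ∏ p ∈ C ℓ, w (plaquetteHolonomy (update U ℓ v) p.1 p.2.1.1 p.2.1.2) ∂(haarProbability G))) ∂q - 1) *
        Real.sqrt (∫ U, (f U - ∫ V, f V ∂π) ^ 2 ∂π) *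
        ((1 - ((∫ V, ∏ p : Plaquette d L, w (plaquetteHolonomy V p.1 p.2.1.1 p.2.1.2) ∂(Measure.pi fun _ : Edge d L => haarProbability G)) /
        ∏ ℓ ∈ T, ∫ h, w h ^ (C ℓ).card ∂(haarProbability G))) ^ b * ∑ t ∈ range N, (1 - ((∫ V, ∏ p : Plaquette d L, w (plaquetteHolonomy V p.1 p.2.1.1 p.2.1.2) ∂(Measure.pi fun _ : Edge d L => haarProbability G)) /
        ∏ ℓ ∈ T, ∫ h, w h ^ (C ℓ).card ∂(haarProbability G))) ^ t) / N := by
  obtain ⟨hA, hρq, hmax, hρm, hρpos⟩ := allClosing_cold_acceptMass_eq hL hw hm0 hm hM hwinv T C hCne hCe hdisj hcover π q hπ hq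
  set cold : GaugeConfig d L G := fun _ => (1 : G) with hcold
  set ρ : GaugeConfig d L G → ℝ := fun U =>
    ((∫ V, ∏ p : Plaquette d L, w (plaquetteHolonomy V p.1 p.2.1.1 p.2.1.2) ∂(Measure.pi fun _ : Edge d L => haarProbability G)) /
      ∏ ℓ ∈ T, (∫ v, ∏ p ∈ C ℓ, w (plaquetteHolonomy (update U ℓ v) p.1 p.2.1.1 p.2.1.2) ∂(haarProbability G))) with hρ
  have hw0' : ∀ U, 0 < (ρ U)⁻¹ := fun U => inv_pos.2 (hρpos U)
  have hπ' : (q.withDensity fun U => ENNReal.ofReal (ρ U)⁻¹) = π := withDensity_inv_density hρm hρpos hρq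
  haveI : IsProbabilityMeasure (q.withDensity fun U => ENNReal.ofReal (ρ U)⁻¹) := by rw [hπ']; infer_instance
  have hone : ∫⁻ y, ENNReal.ofReal (ρ y)⁻¹ ∂q = ENNReal.ofReal 1 := by
    have h : π Set.univ = 1 := measure_univ
    rw [← hπ', withDensity_apply _ MeasurableSet.univ, Measure.restrict_univ] at h
    rw [h, ENNReal.ofReal_one]
  have hA' := imhAcceptMass_toReal_eq_of_forall_le (q := q) hw0' cold hmax zero_le_one hone
  have hrate : ((ρ cold)⁻¹)⁻¹ = ((∫ V, ∏ p : Plaquette d L, w (plaquetteHolonomy V p.1 p.2.1.1 p.2.1.2) ∂(Measure.pi fun _ : Edge d L => haarProbability G)) /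
        ∏ ℓ ∈ T, ∫ h, w h ^ (C ℓ).card ∂(haarProbability G)) := by
    rw [← hA, hA', one_div]
  have hw0g : ∀ g, 0 < w g := fun g => hm0.trans_le (hm g)
  have hcpos : 0 < ∫ g, w g ∂(haarProbability G) := haarProbability_integral_pos_of_continuous_pos hw hw0g
  have hNlo : ∀ ℓ ∈ T, ∀ U : GaugeConfig d L G, m ^ ((C ℓ).card - 1) * (∫ g, w g ∂(haarProbability G)) ≤
      (∫ v, ∏ p ∈ C ℓ, w (plaquetteHolonomy (update U ℓ v) p.1 p.2.1.1 p.2.1.2) ∂(haarProbability G)) := by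
    intro ℓ hℓ U
    obtain ⟨p₀, hp₀⟩ := hCne ℓ hℓ
    exact normaliser_ge hL hw hm0 hm (C ℓ) ℓ hp₀ (hCe ℓ hℓ p₀ hp₀) U
  have hlopos : ∀ ℓ ∈ T, 0 < m ^ ((C ℓ).card - 1) * (∫ g, w g ∂(haarProbability G)) :=
    fun ℓ _ => mul_pos (pow_pos hm0 _) hcpos
  have hNPge : ∀ U : GaugeConfig d L G, ∏ ℓ ∈ T, m ^ ((C ℓ).card - 1) * (∫ g, w g ∂(haarProbability G)) ≤
      ∏ ℓ ∈ T, (∫ v, ∏ p ∈ C ℓ, w (plaquetteHolonomy (update U ℓ v) p.1 p.2.1.1 p.2.1.2) ∂(haarProbability G)) :=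
    fun U => Finset.prod_le_prod (fun ℓ hℓ => (hlopos ℓ hℓ).le) fun ℓ hℓ => hNlo ℓ hℓ U
  have hLpos : 0 < ∏ ℓ ∈ T, m ^ ((C ℓ).card - 1) * (∫ g, w g ∂(haarProbability G)) :=
    Finset.prod_pos fun ℓ hℓ => hlopos ℓ hℓ
  have hne := div_ne_zero_iff.1 (hρpos cold).ne'
  have hZT : (∫ V, ∏ p : Plaquette d L, w (plaquetteHolonomy V p.1 p.2.1.1 p.2.1.2)
      ∂(Measure.pi fun _ : Edge d L => haarProbability G)) ≠ 0 := hne.1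
  have hZTpos : 0 < (∫ V, ∏ p : Plaquette d L, w (plaquetteHolonomy V p.1 p.2.1.1 p.2.1.2)
      ∂(Measure.pi fun _ : Edge d L => haarProbability G)) := by
    have h := hρpos cold
    exact (div_pos_iff.1 h).elim (fun h => h.1) fun h => absurd h.2 (not_lt.2 (le_of_lt
      (Finset.prod_pos fun ℓ hℓ => lt_of_lt_of_le (hlopos ℓ hℓ) (hNlo ℓ hℓ cold))))
  have hwmin : 0 < (∏ ℓ ∈ T, m ^ ((C ℓ).card - 1) * (∫ g, w g ∂(haarProbability G))) /
      (∫ V, ∏ p : Plaquette d L, w (plaquetteHolonomy V p.1 p.2.1.1 p.2.1.2)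
        ∂(Measure.pi fun _ : Edge d L => haarProbability G)) := div_pos hLpos hZTpos
  have hge : ∀ U, (∏ ℓ ∈ T, m ^ ((C ℓ).card - 1) * (∫ g, w g ∂(haarProbability G))) /
      (∫ V, ∏ p : Plaquette d L, w (plaquetteHolonomy V p.1 p.2.1.1 p.2.1.2)
        ∂(Measure.pi fun _ : Edge d L => haarProbability G)) ≤ (ρ U)⁻¹ := by
    intro U
    rw [hρ]
    dsimp only
    rw [inv_div]
    exact div_le_div_of_nonneg_right (hNPge U) hZTpos.le
  have h := imh_chain_windowAverage_bias_hotStart_abs_le_chiSq (q := q) hw0' hmax hwmin hge hf hCf b hN (x₀ := cold)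
  rw [hπ', hrate] at h
  simp only [inv_inv] at h
  exact h

end Summit.Ventures.LatticeQCDFlow.Theory2.Autoregressive

end
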